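import Summits.MatrixMultiplication.OmegaCensus.DominoZ17StructSixRows2
import HarnessLib

/-!
# Completeness rows 11–16 , the remaining tuples and `checkSix` for the structural part-`6` route, `p = 17` (rows file 3 of 3)

ω-census `pub-omega`, family (b3), seat pub-omega-group gen 25.  Framing: lottery ticket; floor = certified bounds/negative
ranges.  VALUE: per-prime kernel data of the structural part-`6` route WITHOUT the pigeonhole (`DominoZpZpStructSixWide*.lean`)
for `p = 17` — target: the OPEN census cell `(1,6,16)@289` (`A = ℤ₁₇²`) and every larger order with such a quotient; NOT progress on ω.

-/

namespace Summit.MatrixMultiplication.OmegaCensus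

open ZpZpDomino

namespace ZpZpDomino

set_option maxRecDepth 100000 in
set_option maxHeartbeats 4000000 in
/-- Row `b = 11` of the completeness check (`17³` lookups). [folklore] -/
theorem checkSixRowv_17_11 : checkSixRow 17 etZ17s6 tabTreeZ17s6v 11 = true := by decide +kernel

set_option maxRecDepth 100000 in
set_option maxHeartbeats 4000000 in
/-- Row `b = 12` of the completeness check (`17³` lookups). [folklore] -/
theorem checkSixRowv_17_12 : checkSixRow 17 etZ17s6 tabTreeZ17s6v 12 = true := by decide +kernel

set_option maxRecDepth 100000 in
set_option maxHeartbeats 4000000 in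
/-- Row `b = 13` of the completeness check (`17³` lookups). [folklore] -/
theorem checkSixRowv_17_13 : checkSixRow 17 etZ17s6 tabTreeZ17s6v 13 = true := by decide +kernel

set_option maxRecDepth 100000 in
set_option maxHeartbeats 4000000 in
/-- Row `b = 14` of the completeness check (`17³` lookups). [folklore] -/
theorem checkSixRowv_17_14 : checkSixRow 17 etZ17s6 tabTreeZ17s6v 14 = true := by decide +kernel

set_option maxRecDepth 100000 in
set_option maxHeartbeats 4000000 in
/-- Row `b = 15` of the completeness check (`17³` lookups). [folklore] -/
theorem checkSixRowv_17_15 : checkSixRow 17 etZ17s6 tabTreeZ17s6v 15 = true := by decide +kernel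

set_option maxRecDepth 100000 in
set_option maxHeartbeats 4000000 in
/-- Row `b = 16` of the completeness check (`17³` lookups). [folklore] -/
theorem checkSixRowv_17_16 : checkSixRow 17 etZ17s6 tabTreeZ17s6v 16 = true := by decide +kernel

set_option maxRecDepth 100000 in
set_option maxHeartbeats 4000000 in
/-- The remaining normalised tuples. [folklore] -/
theorem checkSixRestv_17 : checkSixRest 17 etZ17s6 tabTreeZ17s6v = true := by decide +kernel

/-- **Completeness** (rows assembled). [folklore] -/
theorem checkSixv_17 : checkSix 17 etZ17s6 tabTreeZ17s6v = true := by
  refine checkSix_of_rows (fun b hb => ?_) checkSixRestv_17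
  interval_cases b
  exacts [checkSixRowv_17_0, checkSixRowv_17_1, checkSixRowv_17_2, checkSixRowv_17_3, checkSixRowv_17_4, checkSixRowv_17_5, checkSixRowv_17_6, checkSixRowv_17_7, checkSixRowv_17_8, checkSixRowv_17_9, checkSixRowv_17_10, checkSixRowv_17_11, checkSixRowv_17_12, checkSixRowv_17_13, checkSixRowv_17_14, checkSixRowv_17_15, checkSixRowv_17_16]

end ZpZpDomino

end Summit.MatrixMultiplication.OmegaCensus
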